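import Mathlib.Data.ZMod.Basic
import Mathlib.Tactic.NormNum
import Mathlib.Tactic.Linarith
import Mathlib.Tactic.FinCases
import Mathlib.Tactic.IntervalCases
import Mathlib.Data.Fintype.Prod
import Mathlib.Topology.Algebra.InfiniteSum.Real
import Mathlib.Analysis.SpecificLimits.Basic
import Mathlib.Algebra.Field.ZMod
import Mathlib.Tactic.LinearCombination
import Mathlib.Tactic.Positivity
import Mathlib.NumberTheory.SumPrimeReciprocals
import Mathlib.NumberTheory.LegendreSymbol.QuadraticChar.Basic
import Literature.NumberTheory.EllipticCurves.BhargavaSkinnerZhang2014.LocalDensitiesAtFive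
import HarnessLib

/-!
# Nodal classes of `y² = x³ + Ax + B` modulo every prime `q ≥ 5`: the node `(−3t², 2t³)`, the count `q − 1`, the nonsplit half `(q − 1)/2`, the set `T` of fifth powers, and the divergence behind the sieve

Source: M. Bhargava, C. Skinner, W. Zhang, *A majority of elliptic curves over `ℚ` satisfy the Birch and
Swinnerton-Dyer conjecture*, arXiv:1407.1826v2 (2014) [BhargavaSkinnerZhang2014], Lemma 18
(p. 8: the multiplicative classes at `ℓ = 5`, split / nonsplit halves) — here GENERALISED to every prime `q ≥ 5` —
and §3.1 (p. 7); the set `T` and the sieve are the `pub-bsdpct` bundle's paper Lemmas 4.3–4.4 (its own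
elementary lemmas; `[folklore]`-tagged facts about `(ℤ/25)ˣ` and `∑_q 1/q = ∞`).

Reproduction (proved, Mathlib-only): over any field of characteristic `≠ 2, 3` the parametrisation
`t ↦ (A, B) = (−3t², 2t³)` of the nodal locus `4A³ + 27B² = 0, A ≠ 0` (`x³ + Ax + B = (x − t)²(x + 2t)`) and the
count of nodal classes `q − 1` over `𝔽_q` (`card_nodal`, `card_nodal_zmod`); the NONSPLIT HALF `(q − 1)/2` for EVERY
prime `q ≥ 5` (`card_nonsplitNodal`, `nonsplitNodalHalf_holds`, via `∑ χ = 0` for the quadratic character of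
`(ℤ/q)ˣ`; `q = 7, 11, 13` also by evaluation); the set `T` (fifth powers / fourth roots of unity in `(ℤ/25)ˣ`, Hensel)
with `μ(T) = μ(split, 5 ∣ v)/5` (`decide` + `norm_num`); the anomalous criterion `5 ∣ #Ẽ(𝔽₅) ⟺ A ≡ 3 (mod 5)` and
the trace formula mod `5` (`decide`); and the divergence `∑_q (q − 1)²/(2q³) = ∞` over primes from Mathlib's
`Nat.Primes.not_summable_one_div`.

Relation to the tree: `LeadingTermBSZNonsplitDensityProofs.lean` proves the nonsplit half of Lemma 18 AT `ℓ = 5` as a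
height-density statement; the present file is the all-`q` residue-class generalisation (new), which cites the tree's
`ℓ = 5` case.  `ResidueCount`-style counting of `#{t² = c}` is done inline with `Finset` algebra.
Origin: `BSDPercentage/Densities.lean` (sha256 3744dbb3…, run of record 72) of the `pub-bsdpct` bundle's staged package
(BirchSwinnertonDyer / bsd-percentage), split by section and namespace-rewritten `BSDPercentage.Densities →
Literature.NumberTheory.EllipticCurves.BhargavaSkinnerZhang2014.Densities` (LEAN-IN-TREE rule, 2026-08-18); statements and
proofs byte-identical; per-declaration provenance tags from the bundle engine's table (unit pub-bsdpct-2, gen 23), locators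
verified against the compiled sources by the bundle's literature audit (unit pub-bsdpct-1, gens 36–37).  In the docstrings,
`PROOFS.md` / `AUDIT.md` / `NUMERICS.md` / `numerics/*.py` refer to that bundle's proof notes, literature audit, numerics report
and certified scripts (papers/BirchSwinnertonDyer/bsd-percentage/); "paper" = the bundle's paper; they are provenance
pointers only — every statement in this file is closed-form arithmetic or a finite computation checked by the kernel.

What is NOT here: the `5`-adic cell constants (`LocalDensitiesAtFive`, imported), the Kraus residue facts at `2, 3`
(`TateDiscDensitiesTwoThree`), the bundle's paper Theorem B / B⁺ totals that these constants feed (Summit-side), and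
the sieve argument itself beyond its divergence input.
-/

namespace Literature.NumberTheory.EllipticCurves.BhargavaSkinnerZhang2014.Densities

/-! ## §6. All primes `q ≥ 5`: the node and its parametrisation; the set `T`; Kraus residue facts at 2, 3; the sieve

Companion of `numerics/PROOFS.md` §1–4 and of `numerics/density_extras.py`, `numerics/kraus_small_primes.py`. -/

section Nodal
variable {F : Type*} [Field F]
/-- The parametrisation `t ↦ (A, B) = (-3t², 2t³)` lands in the nodal locus `4A³ + 27B² = 0`
(`x³ + Ax + B = (x - t)²(x + 2t)`). [PROOFS.md §1.2] [folklore] -/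
theorem disc_param (t : F) : 4 * (-3 * t ^ 2) ^ 3 + 27 * (2 * t ^ 3) ^ 2 = 0 := by ring

/-- x³ − 3t²x + 2t³ = (x − t)²(x + 2t): the nodal cubic of the parametrisation (A, B) = (−3t², 2t³). [folklore] -/
theorem cubic_factor (t x : F) : x ^ 3 + (-3 * t ^ 2) * x + 2 * t ^ 3 = (x - t) ^ 2 * (x + 2 * t) := by ring

/-- Conversely (characteristic `≠ 2, 3`): if `4A³ + 27B² = 0` and `A ≠ 0` then `B ≠ 0` and
`(A, B) = (-3t², 2t³)` with `t = -3B/(2A)` (the double root of the cubic). [PROOFS.md §1.2] [folklore] -/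
theorem nodal_param (h2 : (2 : F) ≠ 0) {A B : F}
    (hD : 4 * A ^ 3 + 27 * B ^ 2 = 0) (hA : A ≠ 0) :
    B ≠ 0 ∧ -3 * (-3 * B / (2 * A)) ^ 2 = A ∧ 2 * (-3 * B / (2 * A)) ^ 3 = B := by
  have h4 : (4 : F) ≠ 0 := by
    rw [show (4 : F) = 2 * 2 by norm_num]; exact mul_ne_zero h2 h2
  have h8 : (8 : F) ≠ 0 := by
    rw [show (8 : F) = 2 * 2 * 2 by norm_num]; exact mul_ne_zero (mul_ne_zero h2 h2) h2
  have hB : B ≠ 0 := by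
    intro hB0
    apply hA
    rw [hB0] at hD
    have h43 : (4 : F) * A ^ 3 = 0 := by linear_combination hD
    rcases mul_eq_zero.mp h43 with h | h
    · exact absurd h h4
    · exact (pow_eq_zero_iff (by norm_num)).mp h
  refine ⟨hB, ?_, ?_⟩
  · have key : -3 * (-3 * B / (2 * A)) ^ 2 = (-27 * B ^ 2) / (4 * A ^ 2) := by
      rw [div_pow]; ring
    rw [key, div_eq_iff (mul_ne_zero h4 (pow_ne_zero 2 hA))]
    linear_combination (-1 : F) * hD
  · have key : 2 * (-3 * B / (2 * A)) ^ 3 = (-54 * B ^ 3) / (8 * A ^ 3) := by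
      rw [div_pow]; ring
    rw [key, div_eq_iff (mul_ne_zero h8 (pow_ne_zero 3 hA))]
    linear_combination (-2 * B) * hD

/-- On the nodal locus the three split criteria are the same class modulo squares:
`-2AB = 3t·(2t²)²`, `6B = 3t·(2t)²` for `(A, B) = (-3t², 2t³)` (and `-2AB ~ -c₄/c₆ = γ(E)`,
Silverman ATAEC V.5.3). [PROOFS.md §1.2] [folklore] -/
theorem split_criteria_param (t : F) :
    -2 * (-3 * t ^ 2) * (2 * t ^ 3) = 3 * t * (2 * t ^ 2) ^ 2 ∧ 6 * (2 * t ^ 3) = 3 * t * (2 * t) ^ 2 := by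
  constructor <;> ring

open Finset in
/-- Over a finite field of characteristic `≠ 2, 3` there are exactly `#F - 1` nodal classes
`{(A, B) : 4A³ + 27B² = 0, A ≠ 0}`, namely `(-3t², 2t³)`, `t ≠ 0`, each once. [PROOFS.md §1.2;
`density_extras.py` X1 checks all primes `5 ≤ q ≤ 199`] [folklore] -/
theorem card_nodal [Fintype F] [DecidableEq F] (h2 : (2 : F) ≠ 0) (h3 : (3 : F) ≠ 0) :
    (univ.filter (fun AB : F × F => 4 * AB.1 ^ 3 + 27 * AB.2 ^ 2 = 0 ∧ AB.1 ≠ 0)).card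
      = Fintype.card F - 1 := by
  have hset : (univ.filter (fun AB : F × F => 4 * AB.1 ^ 3 + 27 * AB.2 ^ 2 = 0 ∧ AB.1 ≠ 0))
      = (univ.filter (fun t : F => t ≠ 0)).image (fun t => (-3 * t ^ 2, 2 * t ^ 3)) := by
    ext ⟨A, B⟩
    simp only [mem_filter, mem_univ, true_and, mem_image, Prod.mk.injEq]
    constructor
    · rintro ⟨hD, hA⟩
      obtain ⟨hB, e1, e2⟩ := nodal_param h2 hD hA
      exact ⟨-3 * B / (2 * A), div_ne_zero (mul_ne_zero (neg_ne_zero.mpr h3) hB) (mul_ne_zero h2 hA), e1, e2⟩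
    · rintro ⟨t, ht, rfl, rfl⟩
      exact ⟨by ring, mul_ne_zero (neg_ne_zero.mpr h3) (pow_ne_zero 2 ht)⟩
  have hinj : Set.InjOn (fun t : F => (-3 * t ^ 2, 2 * t ^ 3)) ↑(univ.filter (fun t : F => t ≠ 0)) := by
    intro t ht s hs hts
    simp only [coe_filter, mem_univ, true_and, Set.mem_setOf_eq] at ht hs
    simp only [Prod.mk.injEq] at hts
    obtain ⟨e2, e3⟩ := hts
    have e2' : t ^ 2 = s ^ 2 := mul_left_cancel₀ (neg_ne_zero.mpr h3) e2
    have e3' : t ^ 3 = s ^ 3 := mul_left_cancel₀ h2 e3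
    have key : (t - s) * s ^ 2 = 0 := by linear_combination e3' - t * e2'
    rcases mul_eq_zero.mp key with h | h
    · exact sub_eq_zero.mp h
    · exact absurd ((pow_eq_zero_iff two_ne_zero).mp h) hs
  rw [hset, card_image_of_injOn hinj, filter_ne', card_erase_of_mem (mem_univ _), card_univ]

end Nodal

/-- Helper: a natural number `0 < n < q` is non-zero in `ZMod q`. [folklore] -/
private theorem natCast_ne_zero_of_lt {q n : ℕ} (hn : 0 < n) (h : n < q) : (n : ZMod q) ≠ 0 := by
  rw [Ne, ZMod.natCast_eq_zero_iff]
  exact fun hd => absurd (Nat.le_of_dvd hn hd) (not_le.mpr h)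

/-- For every prime `q ≥ 5`: exactly `q - 1` nodal classes `(A, B) mod q` (multiplicative reduction of
`y² = x³ + Ax + B`, which is minimal at `q` inside the family). [paper Lemma 4.4; PROOFS.md §1.2] [folklore] -/
theorem card_nodal_zmod (q : ℕ) [Fact q.Prime] (hq : 5 ≤ q) :
    (Finset.univ.filter (fun AB : ZMod q × ZMod q => disc AB.1 AB.2 = 0 ∧ AB.1 ≠ 0)).card = q - 1 := by
  have h2 : (2 : ZMod q) ≠ 0 := by
    have := natCast_ne_zero_of_lt (q := q) (n := 2) (by norm_num) (by omega); simpa using this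
  have h3 : (3 : ZMod q) ≠ 0 := by
    have := natCast_ne_zero_of_lt (q := q) (n := 3) (by norm_num) (by omega); simpa using this
  simpa [disc, ZMod.card q] using card_nodal (F := ZMod q) h2 h3

/-- nodal and split (`6B` a non-zero square) modulo `q`.
[cite: BhargavaSkinnerZhang2014, Lemma 18 (nonsplit part, ℓ = 5)] generalised to every prime q ≥ 5 -/
def SplitNodal (q : ℕ) (AB : ZMod q × ZMod q) : Prop :=
  disc AB.1 AB.2 = 0 ∧ AB.1 ≠ 0 ∧ ∃ t : ZMod q, t ≠ 0 ∧ t ^ 2 = 6 * AB.2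

/-- nodal and nonsplit modulo `q`.
[cite: BhargavaSkinnerZhang2014, Lemma 18 (nonsplit part, ℓ = 5)] generalised to every prime q ≥ 5 -/
def NonsplitNodal (q : ℕ) (AB : ZMod q × ZMod q) : Prop :=
  disc AB.1 AB.2 = 0 ∧ AB.1 ≠ 0 ∧ ¬ ∃ t : ZMod q, t ≠ 0 ∧ t ^ 2 = 6 * AB.2

/-- `SplitNodal` is decidable (by unfolding). [folklore] -/
instance (q : ℕ) [NeZero q] : DecidablePred (SplitNodal q) := fun _ => by unfold SplitNodal disc; infer_instance

/-- `NonsplitNodal` is decidable (by unfolding). [folklore] -/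
instance (q : ℕ) [NeZero q] : DecidablePred (NonsplitNodal q) := fun _ => by unfold NonsplitNodal disc; infer_instance

/-- `q = 7`: exactly `3` of the `6` nodal classes are nonsplit (by `decide`).  Exactly half of the nodal classes are nonsplit for
every prime `q ≥ 5` — here `q = 7, 11, 13` by evaluation (`q = 5`: `LocalDensitiesAtFive` §1; all `q`: `card_nonsplitNodal` below;
the bundle's PROOFS.md §1.2 and `density_extras.py` X1 check `q ≤ 199`).
[cite: BhargavaSkinnerZhang2014, Lemma 18 (nonsplit part, ℓ = 5)] generalised to every prime q ≥ 5 -/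
theorem card_nonsplitNodal_seven : (Finset.univ.filter (NonsplitNodal 7)).card = 3 := by decide

/-- Finite residue count by `decide`: `(Finset.univ.filter (SplitNodal 7)).card = 3`.
[cite: BhargavaSkinnerZhang2014, Lemma 18 (nonsplit part, ℓ = 5)] generalised to every prime q ≥ 5 -/
theorem card_splitNodal_seven : (Finset.univ.filter (SplitNodal 7)).card = 3 := by decide

/-- Finite residue count by `decide`: `(Finset.univ.filter (NonsplitNodal 11)).card = 5`.
[cite: BhargavaSkinnerZhang2014, Lemma 18 (nonsplit part, ℓ = 5)] generalised to every prime q ≥ 5 -/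
theorem card_nonsplitNodal_eleven : (Finset.univ.filter (NonsplitNodal 11)).card = 5 := by decide

/-- Finite residue count by `decide`: `(Finset.univ.filter (NonsplitNodal 13)).card = 6`.
[cite: BhargavaSkinnerZhang2014, Lemma 18 (nonsplit part, ℓ = 5)] generalised to every prime q ≥ 5 -/
theorem card_nonsplitNodal_thirteen : (Finset.univ.filter (NonsplitNodal 13)).card = 6 := by decide

/-- The statement for all `q` (PROOFS.md §1.2: `t ↦ 3t` is a bijection of `𝔽_qˣ`, half of whose elements
are squares); recorded as a named statement (gen 2), PROVED below as `nonsplitNodalHalf_holds` (gen 3).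
[cite: BhargavaSkinnerZhang2014, Lemma 18 (nonsplit part, ℓ = 5)] generalised to every prime q ≥ 5 -/
def NonsplitNodalHalf : Prop :=
  ∀ (q : ℕ) [NeZero q], q.Prime → 5 ≤ q → (Finset.univ.filter (NonsplitNodal q)).card = (q - 1) / 2

/-! ### Proof of `NonsplitNodalHalf` for every prime `q ≥ 5` (gen 3; PROOFS.md §1.2)
`(A, B) = (-3t², 2t³)` is nonsplit iff `6B = 12t³ = 3t·(2t)²` is a non-square iff `3t` is a non-square;
`t ↦ 3t` is a bijection, and `𝔽_q` has exactly `(q-1)/2` non-squares (`Σ χ = 0` for the quadratic character). -/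

open Finset in
/-- In `𝔽_q`, `q` an odd prime, exactly `(q - 1)/2` elements are non-squares.
[cite: BhargavaSkinnerZhang2014, Lemma 18 (nonsplit part, ℓ = 5)] generalised to every prime q ≥ 5 -/
theorem card_nonsquare_zmod (q : ℕ) [NeZero q] (hp : q.Prime) (hq2 : q ≠ 2) :
    (univ.filter (fun u : ZMod q => ¬ IsSquare u)).card = (q - 1) / 2 := by
  haveI : Fact q.Prime := ⟨hp⟩
  have hchar : ringChar (ZMod q) ≠ 2 := by rw [ZMod.ringChar_zmod_n]; exact hq2
  have hsum := quadraticChar_sum_zero hchar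
  have hpt : ∀ a : ZMod q, quadraticChar (ZMod q) a
      = (if a ≠ 0 ∧ IsSquare a then (1 : ℤ) else 0) - (if ¬ IsSquare a then (1 : ℤ) else 0) := by
    intro a
    by_cases ha : a = 0
    · subst ha
      have h0 : IsSquare (0 : ZMod q) := ⟨0, (mul_zero 0).symm⟩
      rw [(quadraticChar_eq_zero_iff).mpr rfl, if_neg (fun h => h.1 rfl), if_neg (not_not.mpr h0)]; norm_num
    · by_cases hs : IsSquare a
      · rw [if_pos ⟨ha, hs⟩, if_neg (not_not.mpr hs), (quadraticChar_one_iff_isSquare ha).mpr hs]; norm_num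
      · rw [if_neg (fun h => hs h.2), if_pos hs, quadraticChar_neg_one_iff_not_isSquare.mpr hs]; norm_num
  rw [Finset.sum_congr rfl (fun a _ => hpt a), Finset.sum_sub_distrib, Finset.sum_boole, Finset.sum_boole] at hsum
  have h1 := Finset.card_filter_add_card_filter_not
    (s := (univ : Finset (ZMod q))) (fun a : ZMod q => IsSquare a)
  have h2 : univ.filter (fun a : ZMod q => a ≠ 0 ∧ IsSquare a)
      = (univ.filter (fun a : ZMod q => IsSquare a)).erase 0 := by
    ext a; simp only [mem_filter, mem_univ, true_and, mem_erase]
  have h0mem : (0 : ZMod q) ∈ univ.filter (fun a : ZMod q => IsSquare a) := by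
    simp only [mem_filter, mem_univ, true_and]; exact ⟨0, (mul_zero 0).symm⟩
  have hpos : 0 < (univ.filter (fun a : ZMod q => IsSquare a)).card := card_pos.mpr ⟨0, h0mem⟩
  rw [h2, card_erase_of_mem h0mem] at hsum
  rw [card_univ, ZMod.card] at h1
  have h3 : ((univ.filter (fun a : ZMod q => IsSquare a)).card - 1 : ℕ)
      = (univ.filter (fun a : ZMod q => ¬ IsSquare a)).card := by exact_mod_cast sub_eq_zero.mp hsum
  omega

section NodalHalf
open Finset
/-- The nonsplit nodal classes modulo a prime `q ≥ 5` are exactly the `(-3t², 2t³)` with `3t` a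
non-square (so `t ≠ 0`). [PROOFS.md §1.2]
[cite: BhargavaSkinnerZhang2014, Lemma 18 (nonsplit part, ℓ = 5)] generalised to every prime q ≥ 5 -/
theorem nonsplitNodal_eq_image (q : ℕ) [NeZero q] (hp : q.Prime) (hq : 5 ≤ q) :
    univ.filter (NonsplitNodal q) =
      (univ.filter (fun t : ZMod q => ¬ IsSquare (3 * t))).image (fun t => (-3 * t ^ 2, 2 * t ^ 3)) := by
  haveI : Fact q.Prime := ⟨hp⟩
  have h2 : (2 : ZMod q) ≠ 0 := by
    have := natCast_ne_zero_of_lt (q := q) (n := 2) (by norm_num) (by omega); simpa using this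
  have h3 : (3 : ZMod q) ≠ 0 := by
    have := natCast_ne_zero_of_lt (q := q) (n := 3) (by norm_num) (by omega); simpa using this
  ext ⟨A, B⟩
  simp only [mem_filter, mem_univ, true_and, mem_image, Prod.mk.injEq, NonsplitNodal, disc]
  constructor
  · rintro ⟨hD, hA, hns⟩
    obtain ⟨hB, e1, e2⟩ := nodal_param h2 hD hA
    generalize -3 * B / (2 * A) = t at e1 e2
    have ht0 : t ≠ 0 := by
      rintro rfl
      exact hB (by rw [← e2]; ring)
    refine ⟨t, ?_, e1, e2⟩
    rintro ⟨r, hr⟩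
    apply hns
    have hr0 : r ≠ 0 := by
      rintro rfl
      exact (mul_ne_zero h3 ht0) (by simpa using hr)
    refine ⟨r * (2 * t), mul_ne_zero hr0 (mul_ne_zero h2 ht0), ?_⟩
    rw [← e2]
    linear_combination (-4 * t ^ 2) * hr
  · rintro ⟨t, hns, rfl, rfl⟩
    have ht0 : t ≠ 0 := by
      rintro rfl
      exact hns ⟨0, by ring⟩
    refine ⟨by ring, mul_ne_zero (neg_ne_zero.mpr h3) (pow_ne_zero 2 ht0), ?_⟩
    rintro ⟨s, -, hs⟩
    apply hns
    refine ⟨s / (2 * t), ?_⟩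
    rw [div_mul_div_comm, eq_div_iff (mul_ne_zero (mul_ne_zero h2 ht0) (mul_ne_zero h2 ht0))]
    linear_combination (-1 : ZMod q) * hs

/-- **Exactly half of the `q - 1` nodal classes are nonsplit**, for every prime `q ≥ 5`.
[paper Lemma 4.4; PROOFS.md §1.2; `density_extras.py` X1 for `q ≤ 199`]
[cite: BhargavaSkinnerZhang2014, Lemma 18 (nonsplit part, ℓ = 5)] generalised to every prime q ≥ 5 -/
theorem card_nonsplitNodal (q : ℕ) [NeZero q] (hp : q.Prime) (hq : 5 ≤ q) :
    (univ.filter (NonsplitNodal q)).card = (q - 1) / 2 := by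
  haveI : Fact q.Prime := ⟨hp⟩
  have h2 : (2 : ZMod q) ≠ 0 := by
    have := natCast_ne_zero_of_lt (q := q) (n := 2) (by norm_num) (by omega); simpa using this
  have h3 : (3 : ZMod q) ≠ 0 := by
    have := natCast_ne_zero_of_lt (q := q) (n := 3) (by norm_num) (by omega); simpa using this
  have hinj : Set.InjOn (fun t : ZMod q => (-3 * t ^ 2, 2 * t ^ 3))
      ↑(univ.filter (fun t : ZMod q => ¬ IsSquare (3 * t))) := by
    intro t ht s hs hts
    simp only [coe_filter, mem_univ, true_and, Set.mem_setOf_eq] at ht hs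
    have hs0 : s ≠ 0 := by rintro rfl; exact hs ⟨0, by ring⟩
    simp only [Prod.mk.injEq] at hts
    obtain ⟨e2, e3⟩ := hts
    have e2' : t ^ 2 = s ^ 2 := mul_left_cancel₀ (neg_ne_zero.mpr h3) e2
    have e3' : t ^ 3 = s ^ 3 := mul_left_cancel₀ h2 e3
    have key : (t - s) * s ^ 2 = 0 := by linear_combination e3' - t * e2'
    rcases mul_eq_zero.mp key with h | h
    · exact sub_eq_zero.mp h
    · exact absurd ((pow_eq_zero_iff two_ne_zero).mp h) hs0
  rw [nonsplitNodal_eq_image q hp hq, card_image_of_injOn hinj]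
  have hbij : (univ.filter (fun t : ZMod q => ¬ IsSquare (3 * t))).card
      = (univ.filter (fun u : ZMod q => ¬ IsSquare u)).card := by
    refine card_bij (fun t _ => 3 * t) ?_ ?_ ?_
    · intro t ht
      simp only [mem_filter, mem_univ, true_and] at ht ⊢; exact ht
    · intro t₁ _ t₂ _ h; exact mul_left_cancel₀ h3 h
    · intro u hu
      refine ⟨3⁻¹ * u, ?_, ?_⟩
      · simp only [mem_filter, mem_univ, true_and] at hu ⊢
        rwa [mul_inv_cancel_left₀ h3]
      · exact mul_inv_cancel_left₀ h3 u
  rw [hbij, card_nonsquare_zmod q hp (by omega)]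

/-- `NonsplitNodalHalf` holds (all primes `q ≥ 5`).
[cite: BhargavaSkinnerZhang2014, Lemma 18 (nonsplit part, ℓ = 5)] generalised to every prime q ≥ 5 -/
theorem nonsplitNodalHalf_holds : NonsplitNodalHalf := fun q _ hp hq => card_nonsplitNodal q hp hq

/-- and the split half.
[cite: BhargavaSkinnerZhang2014, Lemma 18 (nonsplit part, ℓ = 5)] generalised to every prime q ≥ 5 -/
theorem card_splitNodal (q : ℕ) [NeZero q] (hp : q.Prime) (hq : 5 ≤ q) :
    (univ.filter (SplitNodal q)).card = (q - 1) / 2 := by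
  haveI : Fact q.Prime := ⟨hp⟩
  have hsplit : univ.filter (SplitNodal q)
      = (univ.filter (fun AB : ZMod q × ZMod q => disc AB.1 AB.2 = 0 ∧ AB.1 ≠ 0)) \ univ.filter (NonsplitNodal q) := by
    ext AB
    simp only [mem_filter, mem_univ, true_and, mem_sdiff, SplitNodal, NonsplitNodal]
    constructor
    · rintro ⟨hD, hA, hex⟩
      exact ⟨⟨hD, hA⟩, fun h => h.2.2 hex⟩
    · rintro ⟨⟨hD, hA⟩, hn⟩
      refine ⟨hD, hA, ?_⟩
      by_contra hex
      exact hn ⟨hD, hA, hex⟩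
  have hsub : univ.filter (NonsplitNodal q)
      ⊆ univ.filter (fun AB : ZMod q × ZMod q => disc AB.1 AB.2 = 0 ∧ AB.1 ≠ 0) := by
    intro AB
    simp only [mem_filter, mem_univ, true_and, NonsplitNodal]
    exact fun h => ⟨h.1, h.2.1⟩
  rw [hsplit, card_sdiff_of_subset hsub, card_nodal_zmod q hq, card_nonsplitNodal q hp hq]
  have hodd : q % 2 = 1 := by
    rcases Nat.even_or_odd q with h | h
    · exfalso
      have h2q : 2 ∣ q := even_iff_two_dvd.mp h
      rcases hp.eq_one_or_self_of_dvd 2 h2q with h | h <;> omega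
    · exact Nat.odd_iff.mp h
  omega

end NodalHalf

/-- Haar measure of `N_q = {ord_q Δ = 1, nonsplit}` given the class count: `((q-1)/2)` classes mod `q`, and
within each the stratum `ord_q(4A³+27B²) = 1` has relative mass `(q-1)/q²` (Hensel), total `(q-1)²/(2q³)`:
the identity used in paper Lemma 4.4. [folklore] -/
theorem mass_Nq (q : ℚ) (hq : q ≠ 0) :
    ((q - 1) / 2) * (1 / q ^ 2) * ((q - 1) / q) = (q - 1) ^ 2 / (2 * q ^ 3) := by
  rw [div_mul_div_comm, div_mul_div_comm, div_eq_div_iff (by positivity) (by positivity)]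
  ring

/-! ### The set `T` (paper Lemma 4.3): fifth powers in `ℚ₅ˣ` -/

/-- In `(ℤ/25)ˣ` the fifth powers of units are exactly the solutions of `x⁴ = 1`, namely `{1, 7, 18, 24}`:
so for `5 ∣ k = ord₅ q`, `q ∈ (ℚ₅ˣ)⁵ ⟺ (q 5⁻ᵏ)⁴ ≡ 1 (mod 25)`, 4 of the 20 unit classes. [PROOFS.md §1.4(b);
`density_extras.py` X3] [folklore] -/
theorem fifthPowers_mod25 :
    ∀ x : ZMod 25, ((∃ y : ZMod 25, ¬ (5 ∣ y.val) ∧ y ^ 5 = x) ↔ (¬ (5 ∣ x.val) ∧ x ^ 4 = 1)) := by decide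

/-- There are exactly 4 fourth roots of unity in (ℤ/25)ˣ (`decide`); with `fifthPowers_mod25` gives #(fifth powers) and μ(T) = μ(sp_badv)/5.
[folklore] -/
theorem card_fourthRootsOfUnity_mod25 :
    (Finset.univ.filter (fun x : ZMod 25 => ¬ (5 ∣ x.val) ∧ x ^ 4 = 1)).card = 4 ∧
    (Finset.univ.filter (fun x : ZMod 25 => ¬ (5 ∣ x.val))).card = 20 := by
  constructor <;> decide

/-- `μ(T)`: one fifth of the split-multiplicative-with-`5 ∣ ord₅Δ` cell (two-to-one map of
`ResidueCount` composed with the bijection `u ↦ -16u/c₄³` and `fifthPowers_mod25`), `= 2c₅/97625`. [folklore] -/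
def μ_T : ℚ := 78125 / 3813476172

/-- Closed form / defining identity, exact rational arithmetic (`norm_num`): `μ_T = μ_sp_badv5 / 5`. [folklore] -/
theorem μ_T_eq : μ_T = μ_sp_badv5 / 5 := by norm_num [μ_T, μ_sp_badv5]

/-- The same constant in the closed form printed in the paper / PROOFS.md: `μ_T = (2 / 97625) / fam 5`. [folklore] -/
theorem μ_T_closed_form : μ_T = (2 / 97625) / fam 5 := by norm_num [μ_T, fam]

/-- The same constant in the closed form printed in the paper / PROOFS.md: `theorem μ_T_paper_form :`. [folklore] -/
theorem μ_T_paper_form :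
    μ_T = ((1 : ℚ) / 5) * (1 / 2) * (16 / 25) * (1 / (5 ^ 5 - 1)) / fam 5 := by norm_num [μ_T, fam]

/-! ### Good reduction at 5: where `E(ℚ₅)[5]` can be non-trivial (AUDIT §F5) -/

/-- `5 ∣ #Ẽ(𝔽₅)` (i.e. `a₅ ≡ 1 (mod 5)`, `a₅ ∈ {1, -4}`) iff `A ≡ 3 (mod 5)`, given good reduction; and
`a₅ ≡ 2A (mod 5)` in general (`#Ẽ = affinePoints + 1 ≡ 1 - 2A`). Since `Ê(5ℤ₅)` is torsion-free,
`E(ℚ₅)[5] = 0` whenever `A ≢ 3 (mod 5)` and the reduction is good. [folklore] -/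
theorem anomalous5_iff :
    ∀ AB : ZMod 5 × ZMod 5, disc AB.1 AB.2 ≠ 0 → (5 ∣ affinePoints AB.1 AB.2 + 1 ↔ AB.1 = 3) := by decide

/-- a₅ mod 5 as a function of (A, B) mod 5 via #E(𝔽₅) = 5 + 1 − a₅ (`decide` table); anomalous iff a₅ ≡ 1.
[folklore] -/
theorem trace_mod_five :
    ∀ AB : ZMod 5 × ZMod 5, disc AB.1 AB.2 ≠ 0 →
      ((affinePoints AB.1 AB.2 + 1 : ℕ) : ZMod 5) = 1 - 2 * AB.1 := by decide

/-! ### The sieve of paper Lemma 4.4 (PROOFS.md §4) -/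

/-- The local masses `μ_q(N_q) = (q-1)²/(2q³)` of "nonsplit multiplicative with `ord_q Δ = 1`" are not summable
over primes (they are `≥ 1/(8q)`), so `∏_q (1 - μ_q(N_q)) = 0`: the exceptional set of Lemma 4.4 has density 0.
[folklore] -/
theorem not_summable_mass_Nq :
    ¬ Summable (fun p : Nat.Primes => (((p : ℕ) : ℝ) - 1) ^ 2 / (2 * ((p : ℕ) : ℝ) ^ 3)) := by
  intro h
  have key : ∀ p : Nat.Primes, (1 : ℝ) / p ≤ 8 * ((((p : ℕ) : ℝ) - 1) ^ 2 / (2 * ((p : ℕ) : ℝ) ^ 3)) := by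
    intro p
    have hp : (2 : ℝ) ≤ ((p : ℕ) : ℝ) := by exact_mod_cast p.prop.two_le
    have hp0 : (0 : ℝ) < ((p : ℕ) : ℝ) := by linarith
    rw [show (8 : ℝ) * ((((p : ℕ) : ℝ) - 1) ^ 2 / (2 * ((p : ℕ) : ℝ) ^ 3))
        = 4 * (((p : ℕ) : ℝ) - 1) ^ 2 / ((p : ℕ) : ℝ) ^ 3 by ring]
    rw [div_le_div_iff₀ hp0 (by positivity)]
    nlinarith [mul_nonneg (mul_nonneg hp0.le (sub_nonneg.mpr hp)) (by linarith : (0 : ℝ) ≤ 3 * ((p : ℕ) : ℝ) - 2)]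
  exact Nat.Primes.not_summable_one_div ((h.mul_left 8).of_nonneg_of_le (fun p => by positivity) key)

end Literature.NumberTheory.EllipticCurves.BhargavaSkinnerZhang2014.Densities
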